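import Mathlib.Algebra.Module.Torsion.Basic
import Mathlib.Algebra.Module.Submodule.Pointwise
import Mathlib.LinearAlgebra.Quotient.Basic
import Mathlib.RingTheory.Ideal.Span
import Mathlib.RingTheory.Ideal.Maps
import Summits.BirchSwinnertonDyer.BirchSwinnertonDyer.Theorems.SignedLowerHalvesSmallImageLowerHalfBothSignsRttD2SpecialisationHKCyclic
import Summits.BirchSwinnertonDyer.BirchSwinnertonDyer.Theorems.SignedLowerHalvesSmallImageLowerHalfBothSignsRttD2SpecialisationDefs
import HarnessLib

/-!
# Route `SignedLowerHalves`, crux L `SmallImageLowerHalfBothSigns` (stmt-BirchSwinnertonDyer-23599), line `rtt_w3` v13 — E2, row (4′) RESHAPED, LEAD: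
# `(H¹ ⧸ R∙ζ)[f] = 0` FROM `H¹[f] = 0` AND `ζ̄` NON-TORSION IN THE SPECIALISATION — NO FREENESS OF `H¹`

WHY (BRIEF-E2 rev 3.1 §3 row (4′); honda g22 TYPER'S NOTE 2026-08-30T15:35Z). Road D's one-call lemma
`SmallImageRttD2LamSpec.lambdaInvariant_quotient_span_zetaSp_le_of_thm52Shape_of_linearEquiv` (-w3 g19) uses `e : H1 ≃ₗ[Λ_{𝒪,2}] Λ_{𝒪,2}` ("`H¹` free of rank one")
ONLY to discharge `Submodule.torsionBy Λ_{𝒪,2} (H1 ⧸ D.Z) f = ⊥` for the specialising element `f = γ − θ(γ)`, and then calls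
`…HKCyclic.lambdaInvariant_quotient_span_singleton_le_of_thm52Shape`, which takes that `torsionBy` hypothesis directly. "`H¹` free over `𝒪⟦T₁,T₂⟧`" is not in
[JLK11] and does not follow from perfectness (honda's Koszul example). THIS FILE replaces it: for ANY commutative ring `R`, `f : R`, module `M` and `ζ : M`,
`M[f] = 0` together with "`l • ζ ∈ f M ⇒ l ∈ (f)`" (the image `ζ̄` of `ζ` in `M ⧸ fM` has annihilator `(f)`, i.e. is non-torsion over `R ⧸ (f)`) give
`(M ⧸ R∙ζ)[f] = 0` (`torsionBy_quotient_span_singleton_eq_bot`). In E2 the second hypothesis is FREE: the junction map `Hsp → ker gX ⊂ Q ≅ Λ_𝒪` sends `ζ̄ ↦ z` with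
`Col z ≠ 0` (`ne_zero_of_eulerProduct`) and `Q` is torsion-free (`smul_mem_smul_top_iff_of_map_ne_zero` packages this step abstractly); the first is the citable
input "`𝐇¹_Iw` has no `f`-torsion" (⟸ `Λ_{𝒪,2}`-torsion-free). THEOREMS ONLY (kernel commutative algebra). [cite: Washington1997, §13.2] [folklore]
-/

set_option linter.dupNamespace false -- D-0017: single-problem summit, the namespace repeats the problem name by design
set_option autoImplicit false

open scoped Pointwise

namespace Summit.BirchSwinnertonDyer.BirchSwinnertonDyer.Theorems.SmallImageRttCharRoad

universe u v w x

variable {R : Type u} [CommRing R] {M : Type v} [AddCommGroup M] [Module R M]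

/-- **`(M ⧸ R∙ζ)[f] = 0` without freeness.** If `M` has no `f`-torsion and every `l : R` with `l • ζ ∈ f • M` lies in `(f)` (the class of `ζ` in `M ⧸ fM` is
non-torsion over `R ⧸ (f)`), then `M ⧸ R∙ζ` has no `f`-torsion: from `f • x = l • ζ` get `l = f l₁`, so `f • (x - l₁ • ζ) = 0`, so `x = l₁ • ζ`.
[cite: Washington1997, §13.2] [folklore] -/
theorem torsionBy_quotient_span_singleton_eq_bot (f : R) (ζ : M) (hM : Submodule.torsionBy R M f = ⊥)
    (hζ : ∀ l : R, l • ζ ∈ f • (⊤ : Submodule R M) → l ∈ Ideal.span {f}) :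
    Submodule.torsionBy R (M ⧸ Submodule.span R {ζ}) f = ⊥ := by
  refine (Submodule.eq_bot_iff _).mpr fun q hq ↦ ?_
  induction q using Submodule.Quotient.induction_on with
  | H x =>
    rw [Submodule.mem_torsionBy_iff, ← Submodule.Quotient.mk_smul, Submodule.Quotient.mk_eq_zero, Submodule.mem_span_singleton] at hq
    obtain ⟨l, hl⟩ := hq
    -- `l • ζ = f • x ∈ f • M`, hence `l = l₁ * f`
    have hlf : l ∈ Ideal.span {f} := hζ l (hl ▸ Submodule.smul_mem_pointwise_smul x f ⊤ Submodule.mem_top)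
    obtain ⟨l₁, rfl⟩ := Ideal.mem_span_singleton'.mp hlf
    -- `f • (x - l₁ • ζ) = 0`, so `x - l₁ • ζ ∈ M[f] = ⊥`
    have hx : x - l₁ • ζ ∈ Submodule.torsionBy R M f := by
      rw [Submodule.mem_torsionBy_iff, smul_sub, ← hl, smul_smul, mul_comm, sub_self]
    rw [hM, Submodule.mem_bot, sub_eq_zero] at hx
    rw [Submodule.Quotient.mk_eq_zero, hx]
    exact Submodule.smul_mem _ _ (Submodule.mem_span_singleton_self ζ)

/-- **The second hypothesis from a map to a torsion-free module.** Let `π : M →ₗ[R] N` kill `f • M` (e.g. `N` = a module over `R ⧸ (f)` reached through the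
specialisation `M ⧸ fM`), let `N` have the property "`l • π ζ = 0 ⇒ l ∈ (f)`" — which holds when `N` is a torsion-free `R ⧸ (f)`-module and `π ζ ≠ 0`. Then
`l • ζ ∈ f • M ⇒ l ∈ (f)`. In E2: `π` = (specialisation `H¹ ↠ Hsp`) ≫ (junction `Hsp → ker gX ⊂ Q ≅ Λ_𝒪`), `π ζ = z`, `Col z ≠ 0`. [folklore] -/
theorem mem_span_of_smul_mem_smul_top {N : Type w} [AddCommGroup N] [Module R N] (f : R) (ζ : M) (π : M →ₗ[R] N)
    (hπ : ∀ m : M, π (f • m) = 0) (hN : ∀ l : R, l • π ζ = 0 → l ∈ Ideal.span {f}) (l : R) (hl : l • ζ ∈ f • (⊤ : Submodule R M)) :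
    l ∈ Ideal.span {f} := by
  refine hN l ?_
  obtain ⟨b, -, hb⟩ := (Submodule.mem_smul_pointwise_iff_exists _ _ _).mp hl
  rw [← map_smul, ← hb, hπ]

/-- **… and that property from torsion-freeness over the specialised ring.** If `R` acts on `N` through `φ : R →+* S` (`l • n = φ l • n`), `φ l = 0 ⇒ l ∈ (f)`
(`ker φ ⊆ (f)`, e.g. `φ` = the specialisation `Λ_{𝒪,2} ↠ Λ_𝒪` with kernel `(f)`), `N` is a torsion-free `S`-module and `n ≠ 0`, then `l • n = 0 ⇒ l ∈ (f)`. In E2: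
`S = Λ_𝒪`, `N = Q ≅ Λ_𝒪`, `n = z ≠ 0`. [folklore] -/
theorem mem_span_of_smul_eq_zero_of_noZeroSMulDivisors {S : Type w} [CommRing S] {N : Type v} [AddCommGroup N] [Module R N] [Module S N]
    [NoZeroSMulDivisors S N] (f : R) (φ : R →+* S) (hφ : ∀ (l : R) (n : N), l • n = φ l • n) (hker : ∀ l : R, φ l = 0 → l ∈ Ideal.span {f})
    (n : N) (hn : n ≠ 0) (l : R) (hl : l • n = 0) : l ∈ Ideal.span {f} := by
  rw [hφ] at hl
  exact hker l ((NoZeroSMulDivisors.eq_zero_or_eq_zero_of_smul_eq_zero hl).resolve_right hn)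

/-- **Row (4′) in road D's coordinates.** For a `ZetaSkeleton` `D` over `R` with `D.Z = D.cyclic a` (one auxiliary `𝔞` with `N𝔞 − σ_𝔞` a unit,
`SmallImageRttD2LamSpec.Z_eq_cyclic_of_isUnit`), `f : R` with `H1[f] = 0`, and an `R`-linear `π : H1 → N` into a module on which `R` acts through
`φ : R →+* S` with `ker φ = (f)` (the specialisation), `N` torsion-free over `S` and `π (_𝔞ζ) ≠ 0`: then `(H1 ⧸ D.Z)[f] = 0` — the hypothesis `hdef` of
`SmallImageRttD2LamSpec.lambdaInvariant_quotient_span_singleton_le_of_thm52Shape`, WITHOUT "`H1` free". In E2: `R = Λ_𝒪⟦T⟧`, `S = Λ_𝒪`, `N = Q ≅ Λ_𝒪`,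
`π = (H1 ↠ Hsp) ≫ eH`, `π (_𝔞ζ) = z`, `Col z ≠ 0`. [cite: JohnsonLeungKings2011, §5.2] [folklore] -/
theorem torsionBy_quotient_Z_eq_bot_of_linearMap {S : Type w} [CommRing S] {Aidx H0 H1 H2 : Type v} {N : Type x} [AddCommGroup H0] [Module R H0]
    [AddCommGroup H1] [Module R H1] [AddCommGroup H2] [Module R H2] [AddCommGroup N] [Module R N] [Module S N] [NoZeroSMulDivisors S N]
    (D : Literature.NumberTheory.ComplexMultiplication.EllipticUnits.JohnsonLeungKings2011.ZetaSkeleton R Aidx H0 H1 H2) (a : Aidx) (hZ : D.Z = D.cyclic a) (f : R)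
    (hM : Submodule.torsionBy R H1 f = ⊥) (φ : R →+* S) (hφ : ∀ (l : R) (n : N), l • n = φ l • n) (hker : RingHom.ker φ = Ideal.span {f})
    (π : H1 →ₗ[R] N) (hπ : π (D.aZeta a) ≠ 0) :
    Submodule.torsionBy R (H1 ⧸ D.Z) f = ⊥ := by
  rw [hZ]
  change Submodule.torsionBy R (H1 ⧸ Submodule.span R {D.aZeta a}) f = ⊥
  have hf : φ f = 0 := by rw [← RingHom.mem_ker, hker]; exact Ideal.mem_span_singleton_self f
  refine torsionBy_quotient_span_singleton_eq_bot f (D.aZeta a) hM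
    (mem_span_of_smul_mem_smul_top f (D.aZeta a) π (fun m ↦ by rw [map_smul, hφ, hf, zero_smul])
      (mem_span_of_smul_eq_zero_of_noZeroSMulDivisors f φ hφ (fun l hl ↦ by rw [← hker]; exact hl) (π (D.aZeta a)) hπ))

open PowerSeries in
open Summit.BirchSwinnertonDyer.BirchSwinnertonDyer.Theorems.SmallImageRttD2Spec in
/-- **Row (4′) SUPPLIER in road D's coordinates (-w3 g19's `φ, hC, hX, hker`, `Hsp = QuotSMulTop f H1` with `Λ_𝒪`-structure `hιH`).** If `H1` has no
`f`-torsion (`f = C (X − C b)`), `D.Z = D.cyclic a`, and there is a `Λ_𝒪`-LINEAR map `eH : Hsp → N` into a torsion-free `Λ_𝒪`-module with `eH (zetaSp f D a) ≠ 0`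
(in E2: the junction `eH : Hsp → ker gX ⊂ Q ≅ Λ_𝒪`, `eH ζ̄ = z`, `Col z ≠ 0`), then `(H1 ⧸ D.Z)[f] = 0` = the binder `hdef` of
`SmallImageRttD2LamSpec.lambdaInvariant_quotient_span_singleton_le_of_thm52Shape`. No "`H1` free of rank one". [cite: JohnsonLeungKings2011, §5.2] [folklore] -/
theorem torsionBy_quotient_Z_eq_bot_of_quotSMulTop_linearMap {A : Type u} [CommRing A] (b : A) (φ : PowerSeries (PowerSeries A) →+* PowerSeries A)
    (hC : ∀ a : A, φ (C (C a)) = C a) (hX : φ X = X) (hker : RingHom.ker φ = Ideal.span {C (X - C b)})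
    {Aidx H0 H1 H2 : Type v} {N : Type x} [AddCommGroup H0] [Module (PowerSeries (PowerSeries A)) H0] [AddCommGroup H1]
    [Module (PowerSeries (PowerSeries A)) H1] [AddCommGroup H2] [Module (PowerSeries (PowerSeries A)) H2]
    [AddCommGroup N] [Module (PowerSeries A) N] [NoZeroSMulDivisors (PowerSeries A) N]
    (D : Literature.NumberTheory.ComplexMultiplication.EllipticUnits.JohnsonLeungKings2011.ZetaSkeleton (PowerSeries (PowerSeries A)) Aidx H0 H1 H2)
    (a : Aidx) (hZ : D.Z = D.cyclic a) (hM : Submodule.torsionBy (PowerSeries (PowerSeries A)) H1 (C (X - C b)) = ⊥)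
    [Module (PowerSeries A) (QuotSMulTop (C (X - C b) : PowerSeries (PowerSeries A)) H1)]
    (hιH : ∀ (l : PowerSeries A) (x : QuotSMulTop (C (X - C b) : PowerSeries (PowerSeries A)) H1),
      l • x = (PowerSeries.map (PowerSeries.C : A →+* PowerSeries A) l) • x)
    (eH : QuotSMulTop (C (X - C b) : PowerSeries (PowerSeries A)) H1 →ₗ[PowerSeries A] N) (hz : eH (zetaSp (C (X - C b)) D a) ≠ 0) :
    Submodule.torsionBy (PowerSeries (PowerSeries A)) (H1 ⧸ D.Z) (C (X - C b)) = ⊥ := by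
  letI : Module (PowerSeries (PowerSeries A)) N := Module.compHom N φ
  -- `π := eH ∘ mk : H1 → N` is `R`-linear for the `φ`-structure on `N`
  let π : H1 →ₗ[PowerSeries (PowerSeries A)] N :=
    { toFun := fun x ↦ eH (Submodule.Quotient.mk x)
      map_add' := fun x y ↦ by rw [Submodule.Quotient.mk_add, map_add]
      map_smul' := fun r x ↦ by
        rw [Submodule.Quotient.mk_smul, SmallImageRttD2LamSpec.smul_eq_map_apply_smul_quotSMulTop b φ hC hX hker H1 r, ← hιH, map_smul]
        rfl }
  exact torsionBy_quotient_Z_eq_bot_of_linearMap D a hZ (C (X - C b)) hM φ (fun _ _ ↦ rfl) hker π hz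

end Summit.BirchSwinnertonDyer.BirchSwinnertonDyer.Theorems.SmallImageRttCharRoad
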